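import Mathlib
import Summits.KontsevichZagierPeriods.Zeta5Search.DenomLaw.PathWeightProfile
import Summits.KontsevichZagierPeriods.Zeta5Search.CellKitRays
import HarnessLib

/-!
# ζ(5) search — `C⋆` on the first-period θ-cells of TOP_STAIR #1 = ray H1 (profile checks over the 5,040 vertex orderings)

Cell `pub-zeta5` (HONEST FRAMING: systematic search; no irrationality claim unless certified), TRACK «DENOM-LAW» D1 prover seat
(denom-prover-d1 g13, `HOME/denom-law/prover-d1/ATTEMPT-13.md`).  The PATH ACCOUNTING node's combinatorial datum `C⋆_p(b) = cStar b p` on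
TOP_STAIR #1 = ray H1, `b(n) = n·(34; 14,13,12,11,10,9,8) = bLin (8n) (6n) n` (parameters `(14 − i)·n`, pair blocks `(6 + i + k)·n`): by the tree's
profile tool `cStar_le_of_profile` (`DenomLaw/PathWeightProfile`, g11), a lower bound on `p` fixes which parameters (`i ≤ 13 − ℓ`) and which pair blocks
(`i + k ≥ ℓ − 5`) may reach `p`, and one `decide` over the 5,040 orderings bounds `C⋆`: `≤ 9` for `p > 10n`, `≤ 8` for `p > 11n`, `≤ 6` for
`p > 12n`, `≤ 5` for `p > 13n` (all attained on the next cell: `HOME/…/g13/tables/recon_ts1_n40.txt`; on `(8.5n, 10n]` the tree's generic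
`cStar_le_eleven` is already sharp).  Consumed by
`DenomLaw/TS1RayPath`.  Pure combinatorics; nothing about ζ(5) or irrationality.
-/

open Finset

namespace Summit.KontsevichZagierPeriods.Zeta5Search.StairTS1

open Summit.KontsevichZagierPeriods.Zeta5Search.DenomLaw (cStar)
open Summit.KontsevichZagierPeriods.Zeta5Search.DenomLaw.FirstPeriodKit (cStar_le_of_profile)
open Summit.KontsevichZagierPeriods.Zeta5Search.CellKit (bLin)

/-- The ray's lower parameters: `b(n)_{i+1} = (14 − i)·n` for `i < 7`. -/
theorem h1_param (n : ℕ) (i : Fin 7) : bLin (8 * n) (6 * n) n (i.val + 1) = (14 - (i.val : ℤ)) * n := by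
  fin_cases i <;> simp [bLin] <;> ring

/-- The ray's pair blocks: `34n − (14−i)n − (14−k)n = (6 + i + k)·n`. -/
theorem h1_block (n : ℕ) (i k : Fin 7) :
    bLin (8 * n) (6 * n) n 0 - bLin (8 * n) (6 * n) n (i.val + 1) - bLin (8 * n) (6 * n) n (k.val + 1) = (6 + (i.val : ℤ) + k.val) * n := by
  rw [h1_param, h1_param]; simp [bLin]; ring

/-- **`C⋆ ≤ 9` for `p > 10n`** (longs `i ≤ 3`; heavy `i + k ≥ 5`; attained on `(10n, 11n]`). -/
theorem cStar_h1_le_nine {n p : ℕ} (hp : 10 * n < p) : cStar (bLin (8 * n) (6 * n) n) p ≤ 9 := by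
  refine cStar_le_of_profile (fun i : Fin 7 => i.val ≤ 3) (fun i k : Fin 7 => 5 ≤ i.val + k.val) 9 ?_ ?_ (by decide +kernel)
  · intro i hi
    rw [h1_param] at hi
    have hp' : (10 * n : ℤ) < p := by exact_mod_cast hp
    by_contra hc
    push Not at hc
    have h4 : (4 : ℤ) ≤ i.val := by exact_mod_cast hc
    nlinarith
  · intro i k hik
    rw [h1_block] at hik
    have hp' : (10 * n : ℤ) < p := by exact_mod_cast hp
    by_contra hc
    push Not at hc
    have h4 : (i.val : ℤ) + k.val ≤ 4 := by exact_mod_cast (by omega : i.val + k.val ≤ 4)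
    nlinarith

/-- **`C⋆ ≤ 8` for `p > 11n`** (longs `i ≤ 2`; heavy `i + k ≥ 6`; attained on `(11n, 12n]`). -/
theorem cStar_h1_le_eight {n p : ℕ} (hp : 11 * n < p) : cStar (bLin (8 * n) (6 * n) n) p ≤ 8 := by
  refine cStar_le_of_profile (fun i : Fin 7 => i.val ≤ 2) (fun i k : Fin 7 => 6 ≤ i.val + k.val) 8 ?_ ?_ (by decide +kernel)
  · intro i hi
    rw [h1_param] at hi
    have hp' : (11 * n : ℤ) < p := by exact_mod_cast hp
    by_contra hc
    push Not at hc
    have h3 : (3 : ℤ) ≤ i.val := by exact_mod_cast hc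
    nlinarith
  · intro i k hik
    rw [h1_block] at hik
    have hp' : (11 * n : ℤ) < p := by exact_mod_cast hp
    by_contra hc
    push Not at hc
    have h5 : (i.val : ℤ) + k.val ≤ 5 := by exact_mod_cast (by omega : i.val + k.val ≤ 5)
    nlinarith

/-- **`C⋆ ≤ 6` for `p > 12n`** (longs `i ≤ 1`; heavy `i + k ≥ 7`; attained on `(12n, 13n]`). -/
theorem cStar_h1_le_six {n p : ℕ} (hp : 12 * n < p) : cStar (bLin (8 * n) (6 * n) n) p ≤ 6 := by
  refine cStar_le_of_profile (fun i : Fin 7 => i.val ≤ 1) (fun i k : Fin 7 => 7 ≤ i.val + k.val) 6 ?_ ?_ (by decide +kernel)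
  · intro i hi
    rw [h1_param] at hi
    have hp' : (12 * n : ℤ) < p := by exact_mod_cast hp
    by_contra hc
    push Not at hc
    have h2 : (2 : ℤ) ≤ i.val := by exact_mod_cast hc
    nlinarith
  · intro i k hik
    rw [h1_block] at hik
    have hp' : (12 * n : ℤ) < p := by exact_mod_cast hp
    by_contra hc
    push Not at hc
    have h6 : (i.val : ℤ) + k.val ≤ 6 := by exact_mod_cast (by omega : i.val + k.val ≤ 6)
    nlinarith

/-- **`C⋆ ≤ 5` for `p > 13n`** (longs `i = 0` only; heavy `i + k ≥ 8`; attained on `(13n, 14n]`). -/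
theorem cStar_h1_le_five {n p : ℕ} (hp : 13 * n < p) : cStar (bLin (8 * n) (6 * n) n) p ≤ 5 := by
  refine cStar_le_of_profile (fun i : Fin 7 => i.val ≤ 0) (fun i k : Fin 7 => 8 ≤ i.val + k.val) 5 ?_ ?_ (by decide +kernel)
  · intro i hi
    rw [h1_param] at hi
    have hp' : (13 * n : ℤ) < p := by exact_mod_cast hp
    by_contra hc
    push Not at hc
    have h1 : (1 : ℤ) ≤ i.val := by exact_mod_cast hc
    nlinarith
  · intro i k hik
    rw [h1_block] at hik
    have hp' : (13 * n : ℤ) < p := by exact_mod_cast hp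
    by_contra hc
    push Not at hc
    have h7 : (i.val : ℤ) + k.val ≤ 7 := by exact_mod_cast (by omega : i.val + k.val ≤ 7)
    nlinarith

end Summit.KontsevichZagierPeriods.Zeta5Search.StairTS1
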